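import Mathlib
import Summits.ValiantsHypothesis.ValiantsHypothesis.Theorems.RigidityForcesSymmetryRankRigidMinimalReprLaplaceFiveSectorSplitDefs
import Summits.ValiantsHypothesis.ValiantsHypothesis.Theorems.RigidityForcesSymmetryRankRigidMinimalReprLaplaceFiveSumRigidC4IdentB
import Summits.ValiantsHypothesis.ValiantsHypothesis.Theorems.RigidityForcesSymmetryRankRigidMinimalReprLaplaceFiveSumRigidC4IdentA
import Summits.ValiantsHypothesis.ValiantsHypothesis.Theorems.RigidityForcesSymmetryRankRigidMinimalReprLaplaceFiveSumRigidC4Endgame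
import Summits.ValiantsHypothesis.ValiantsHypothesis.Theorems.RigidityForcesSymmetryRankRigidMinimalReprLaplaceFiveRelabel

/-!
# ValiantsHypothesis / RigidityForcesSymmetry — crux `LaplaceOptimalFive` (stmt-ValiantsHypothesis-24813), crux idea
`young-shadow` (K1): **K1 HOLDS ON THE 4-CYCLE SUPPORT `C₄ = {01, 12, 23, 03}`** (composition)

A side-symmetric pair decomposition of `P₅ = [v injective]` all of whose splits lie on the canonical 4-cycle of slots
`{0,1}, {1,2}, {2,3}, {0,3}` has at least ten terms, hence Laplace weight `≥ 120 = 5!`.  Composition of the SUM-RIGIDITY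
certificates ✓ `LaplaceFiveSumRigidC4.ident11111 / ident2111 / ident221` (val-idea-19 g7, ported) with the endgame
✓ `LaplaceFiveSumRigidC4.endgame` — the kernel form of §12 of the pen note `NOTE-g7-24813-star-closed-rays.md` (refereed
val-idea-crit-3 g5): `C₄` is SUM-RIGID, its `(4,1)`-slack (census `224`) cancels in the total letter matrix, so no separation and no
rigidity is needed.  With ✓ `sideSym_threePairSplits` (≤ 3 splits) and ✓ `sideSym_fourPairSplits_rigid` (P₅ / paw / chair) the
`k = 4` TRUE-side census of K1 reads: rigid ✓ · `C₄` ✓ (this file: canonical position, and every 4-cycle `π0 π1 π2 π3` by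
✓ `LaplaceFiveRelabel.weight_ge_of_relabel`) · star
(paper proof refereed; Lean: ✓ symmetric-shadow / rank-one / lone-term files, LEMMA 2′ open) · `K₃ ⊔ K₂` OPEN.

Honest framing.  K1 `SideSymLaplaceOptimalFive` in general, S2′, `LaplaceOptimalFive` (OPEN · CONTESTED 72/120), `RankRigidMinimalRepr`,
`VP ≠ VNP` are NOT proved.  No definitions, no `sorry`; Mathlib + tree only.
-/

set_option linter.dupNamespace false

namespace Summit.ValiantsHypothesis.ValiantsHypothesis.Theorems.RigidityForcesSymmetryRankRigidMinimalRepr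

namespace LaplaceFiveSumRigidC4

open Finset LaplaceFiveSectorSplit

variable {N : ℕ}

/-- **K1 on the canonical 4-cycle support, term count**: a side-symmetric pair decomposition of `P₅` supported on
`{01, 12, 23, 03}` has at least ten terms. [folklore] -/
theorem sideSym_C4canon_ten_le (T : Finset (Fin N)) (S : Fin N → Finset (Fin 5)) (u w : Fin N → (Fin 5 → Fin 5) → ℂ)
    (hdec : IsSplitDecomposition T S u w) (hsym : SideSymmetric T S u w)
    (hC : ∀ t ∈ T, S t = {0, 1} ∨ S t = {1, 2} ∨ S t = {2, 3} ∨ S t = {0, 3}) : 10 ≤ T.card :=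
  endgame T S u w hdec hsym hC
    (fun a b c d e h => ident11111 T S u w hdec hsym hC a b c d e h)
    (fun a b c d h => ident2111 T S u w hdec hsym hC a b c d h)
    (fun a b c h => ident221 T S u w hdec hsym hC a b c h)

/-- **K1 on the canonical 4-cycle support, Laplace weight `≥ 5!`** (every term is a pair term of weight `2!·3! = 12`). [folklore] -/
theorem sideSym_C4canon (T : Finset (Fin N)) (S : Fin N → Finset (Fin 5)) (u w : Fin N → (Fin 5 → Fin 5) → ℂ)
    (hdec : IsSplitDecomposition T S u w) (hsym : SideSymmetric T S u w)
    (hC : ∀ t ∈ T, S t = {0, 1} ∨ S t = {1, 2} ∨ S t = {2, 3} ∨ S t = {0, 3}) :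
    Nat.factorial 5 ≤ laplaceWeight T S := by
  classical
  have hten := sideSym_C4canon_ten_le T S u w hdec hsym hC
  have hcard : ∀ t ∈ T, (S t).card = 2 := by
    intro t ht
    rcases hC t ht with h | h | h | h <;> rw [h] <;> decide
  have hw12 : ∀ t ∈ T, (S t).card.factorial * (5 - (S t).card).factorial = 12 := by
    intro t ht
    rw [hcard t ht]
    decide
  unfold laplaceWeight
  rw [Finset.sum_congr rfl hw12, Finset.sum_const, smul_eq_mul]
  have : Nat.factorial 5 = 120 := by decide
  omega

/-- **K1 on every 4-cycle support**: a side-symmetric pair decomposition of `P₅` whose splits lie on a 4-cycle of slots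
`{π0 π1, π1 π2, π2 π3, π0 π3}` (`π` any slot permutation) weighs `≥ 5!`. [folklore] -/
theorem sideSym_C4 (T : Finset (Fin N)) (S : Fin N → Finset (Fin 5)) (u w : Fin N → (Fin 5 → Fin 5) → ℂ)
    (hdec : IsSplitDecomposition T S u w) (hsym : SideSymmetric T S u w) (π : Equiv.Perm (Fin 5))
    (hC : ∀ t ∈ T, S t = {π 0, π 1} ∨ S t = {π 1, π 2} ∨ S t = {π 2, π 3} ∨ S t = {π 0, π 3}) :
    Nat.factorial 5 ≤ laplaceWeight T S := by
  classical
  refine LaplaceFiveRelabel.weight_ge_of_relabel ({{0, 1}, {1, 2}, {2, 3}, {0, 3}} : Finset (Finset (Fin 5))) ?_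
    T S u w hdec hsym π⁻¹ ?_
  · intro N' T' S' u' w' hdec' hsym' hF
    refine sideSym_C4canon T' S' u' w' hdec' hsym' fun t ht => ?_
    have h := hF t ht
    simp only [Finset.mem_insert, Finset.mem_singleton] at h
    exact h
  · intro t ht
    have hinv : ∀ i : Fin 5, π⁻¹ (π i) = i := fun i => π.symm_apply_apply i
    rcases hC t ht with h | h | h | h <;> rw [h, LaplaceFiveRelabel.image_pair, hinv, hinv] <;> simp

end LaplaceFiveSumRigidC4

end Summit.ValiantsHypothesis.ValiantsHypothesis.Theorems.RigidityForcesSymmetryRankRigidMinimalRepr
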